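import Summits.Ventures.Crystal3D.Theorems.StickyWulffConstantCoaxialWallLawLayeredFrame
import Summits.Ventures.Crystal3D.Theorems.StickyWulffConstantCoaxialWallLawInPlaneRunEnds
import Summits.Ventures.Crystal3D.Theorems.StickyWulffConstantCoaxialWallLawPayerAssembly
import HarnessLib

/-!
# The layered (on-site) rung of `stub_coaxialTwoSlabAdhesion`: the stub's inequality for every filling on the co-axial site lattice

HONEST FRAMING. Part of the venture `Summits/Ventures/Crystal3D` (cell `crystal3d-full`), helper
`--supports` the crux `CoaxialWallLaw` (stmt-Ventures-19481, `route-Ventures-StickyWulffConstant`),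
REGISTERED line `WallLedgerF` (planner cf-p1 gen 16), open stub `stub_coaxialTwoSlabAdhesion`.
RUNG CREDIT ONLY: the stub quantifies over ARBITRARY unit-separated fillings; here the filling is LAYERED
(every ball a site of the co-axial site lattice `L(ℤu₁ + ℤu₂ + ℤw + ℤν) + s₁` of the shared frame:
microtwinned lamella stacks, stacking-fault ribbons, partial-coset domains with intermediate lamellae,
vacancies — the route's recorded `why_might_fail` family for this crux and the named breaking point
«bonds_FF of lamellar fillings» of the planner's line B, memo F-TOPDOWN).  It generalises the RIGID rung
`…CoaxialWallLawRigidAll.coaxialTwoSlabAdhesion_rigid` (`X ⊆ Λ₁ ∪ Λ₂`).  F-C1 is not moved.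

THE MECHANISM (census-free, kissing-free, multiplicity ONE).  By the local law
`…LayeredLocal.layered_card_contacts_add_vacant_le`, every vacant in-plane site of a ball of a layered
filling is a missing contact OF THAT BALL; by `…InPlaneRunEnds`, along each of the three non-descending
in-plane slots `d` of grain 1 the located run ends (`e ∈ X`, `e + d ∉ X`, in the payer window) number at
least `(2/3)·√2|⟪d,e₃⟫|·πρ² − O(ρ)` (all fillings; `2/3` = the composition layers of a twin pair, `1` for
translation pairs); distinct (ball, slot) pairs are distinct missing bonds; and the three in-plane classes
carry `√2 Σ|⟪dᵢ,e₃⟫| ≥ √6 sin θ` (`coaxial_sine_le_inPlaneClasses`).  Hence the payer bound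
`Σ_window (12 − deg) ≥ (2/3)√6 sin θ · πρ² − C₀ρ`, and `…PayerAssembly.twoSlab_cross_le_of_deficit` turns it
into the stub's shape with constant `√6/3 ≈ 0.8165 > ½`:

* `card_inPlane_runEnds_ge_coaxial` — per slot: located ends `≥ (2/3)√2|⟪d,e₃⟫|πρ² − (12√2π + 72R₀)ρ`.
* **`coaxialTwoSlabAdhesion_layered_sharp`** — for the crux's frame data `(L, s₁, s₂, σ, σ')`, `Λ₁ ≠ Λ₂`:
  `cross(P₁, X∖P₁) + cross(P₂, Y) ≤ D(Y) + (φ₁ + φ₂ − (√6/3)·√(1 − ⟪L e₃, e₃⟫²))πρ² + C(1+h)ρ` for every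
  layered filling of the stub's cell (`R₀ = 10`).
* **`coaxialTwoSlabAdhesion_layered`** — the stub `CoaxialTwoSlabAdhesion` VERBATIM (hypotheses, the
  re-picked frame, constant `½`) with the single extra premise «`X` on the site lattice of `(L, s₁)`» inside.

CONSEQUENCE FOR THE PROGRAMME: a counterexample to `c₁ = ½` for arbitrary fillings must move filling balls
OFF the co-axial site lattice (foreign `{111}` plates, off-site relaxation at risers); the factor `78` of the
word accounting (`…PayerTwin`) is an off-site phenomenon.  Not claimed: anything off-site; the symmetric
count from grain 2 (which doubles the constant) is not typed.
-/

noncomputable section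

namespace Summit.Ventures.Crystal3D.Theorems

open Summit.Ventures.Crystal3D Finset
open Literature.MathematicalPhysics.StatisticalMechanics (fccStacking barlowStacking IsHaggSeq
  contactDeficiency triangularVec₁ triangularVec₂ barlowOffset layerNormal)
open scoped InnerProductSpace

/-! ## The per-slot count for a co-axial pair -/

open scoped Classical in
/-- **Located in-plane run ends of grain 1 along a signed in-plane class, co-axial pair** (translation
pairs via disjointness, twin pairs via the layer shift; unified linear loss).  See the module docstring. -/
theorem card_inPlane_runEnds_ge_coaxial
    (A₁ : EuclideanSpace ℝ (Fin 3) ≃ₗᵢ[ℝ] EuclideanSpace ℝ (Fin 3)) (t₁ : EuclideanSpace ℝ (Fin 3))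
    (A₂ : EuclideanSpace ℝ (Fin 3) ≃ₗᵢ[ℝ] EuclideanSpace ℝ (Fin 3)) (t₂ : EuclideanSpace ℝ (Fin 3))
    (L : EuclideanSpace ℝ (Fin 3) ≃ₗᵢ[ℝ] EuclideanSpace ℝ (Fin 3)) (s₁ s₂ : EuclideanSpace ℝ (Fin 3))
    {σ σ' : ℤ → ℤ} (hσ : IsHaggSeq σ) (hσ' : IsHaggSeq σ')
    (hsub₁ : (fun p => A₁ p + t₁) '' fccStacking 1 (Real.sqrt (2 / 3)) ⊆
      (fun p => L p + s₁) '' barlowStacking 1 (Real.sqrt (2 / 3)) σ)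
    (hsub₂ : (fun p => A₂ p + t₂) '' fccStacking 1 (Real.sqrt (2 / 3)) ⊆
      (fun p => L p + s₂) '' barlowStacking 1 (Real.sqrt (2 / 3)) σ')
    (hne : (fun p => A₁ p + t₁) '' fccStacking 1 (Real.sqrt (2 / 3)) ≠
      (fun p => A₂ p + t₂) '' fccStacking 1 (Real.sqrt (2 / 3)))
    (X P₁ P₂ : Finset (EuclideanSpace ℝ (Fin 3))) (R₀ h ρ : ℝ) (hR₀ : 10 ≤ R₀) (hρ : R₀ ≤ ρ)
    (hX : ∀ p ∈ X, ∀ q ∈ X, p ≠ q → 1 ≤ dist p q)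
    (hcell : ∀ p ∈ X, -(2 * R₀) ≤ p 2 ∧ p 2 ≤ h + 2 * R₀ ∧ p 0 ^ 2 + p 1 ^ 2 ≤ ρ ^ 2)
    (hP₁X : P₁ ⊆ X) (hP₂X : P₂ ⊆ X)
    (hP₁ : ∀ p, p ∈ P₁ ↔ (p ∈ (fun q => A₁ q + t₁) '' fccStacking 1 (Real.sqrt (2 / 3)) ∧
      -(2 * R₀) ≤ p 2 ∧ p 2 ≤ -R₀ ∧ p 0 ^ 2 + p 1 ^ 2 ≤ ρ ^ 2))
    (hP₂ : ∀ p, p ∈ P₂ ↔ (p ∈ (fun q => A₂ q + t₂) '' fccStacking 1 (Real.sqrt (2 / 3)) ∧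
      h + R₀ ≤ p 2 ∧ p 2 ≤ h + 2 * R₀ ∧ p 0 ^ 2 + p 1 ^ 2 ≤ ρ ^ 2))
    {u : EuclideanSpace ℝ (Fin 3)} (hu : u ∈ fccSlots)
    (hup : 0 ≤ ⟪A₁ u, EuclideanSpace.single (2 : Fin 3) (1 : ℝ)⟫_ℝ)
    {ε : ℝ} (hε : ε = 1 ∨ ε = -1) (i j : ℤ)
    (hAu : A₁ u = L (ε • ((i : ℝ) • triangularVec₁ (1 : ℝ) + (j : ℝ) • triangularVec₂ 1))) :
    2 / 3 * Real.sqrt 2 * |⟪A₁ u, EuclideanSpace.single (2 : Fin 3) (1 : ℝ)⟫_ℝ| * Real.pi * ρ ^ 2 -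
        (12 * Real.sqrt 2 * Real.pi + 72 * R₀) * ρ ≤
      ((X.filter fun e => e ∈ (fun q => A₁ q + t₁) '' fccStacking 1 (Real.sqrt (2 / 3)) ∧
        e ∉ (fun q => A₂ q + t₂) '' fccStacking 1 (Real.sqrt (2 / 3)) ∧
        e + A₁ u ∉ X ∧ -R₀ - 2 ≤ e 2 ∧ e 2 ≤ h + R₀ + 2).card : ℝ) := by
  set Λ₂ := (fun q => A₂ q + t₂) '' fccStacking 1 (Real.sqrt (2 / 3)) with hΛ₂
  have hρ0 : (0 : ℝ) ≤ ρ := by linarith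
  set a : ℝ := |⟪A₁ u, EuclideanSpace.single (2 : Fin 3) (1 : ℝ)⟫_ℝ| with ha
  have ha0 : 0 ≤ a := abs_nonneg _
  have ha1 : a ≤ 1 := abs_inner_slot_le_one A₁ hu
  set M : ℝ := Real.sqrt 2 * Real.pi with hM
  have hM0 : 0 ≤ M := by positivity
  -- `Λ₂` is invariant under `± A₁ u`
  have hper : ∀ x ∈ Λ₂, ∀ a b : ℤ, x + L ((a : ℝ) • triangularVec₁ (1 : ℝ) + (b : ℝ) • triangularVec₂ 1) ∈ Λ₂ :=
    fun x hx a b => coaxial_inPlane_slot_mem A₂ t₂ L s₂ hσ' hsub₂ hx a b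
  have hinv₂ : ∀ x, x ∈ Λ₂ → x + A₁ u ∈ Λ₂ ∧ x - A₁ u ∈ Λ₂ := by
    intro x hx
    rcases hε with rfl | rfl
    · rw [one_smul] at hAu
      refine ⟨by rw [hAu]; exact hper x hx i j, ?_⟩
      have e : x - A₁ u = x + L ((((-i : ℤ)) : ℝ) • triangularVec₁ (1 : ℝ) + (((-j : ℤ)) : ℝ) • triangularVec₂ 1) := by
        rw [hAu, sub_eq_add_neg, ← map_neg]
        congr 2
        push_cast
        module
      rw [e]; exact hper x hx (-i) (-j)
    · rw [neg_one_smul, map_neg] at hAu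
      refine ⟨?_, by rw [hAu, sub_neg_eq_add]; exact hper x hx i j⟩
      have e : x + A₁ u = x + L ((((-i : ℤ)) : ℝ) • triangularVec₁ (1 : ℝ) + (((-j : ℤ)) : ℝ) • triangularVec₂ 1) := by
        rw [hAu, ← map_neg]
        congr 2
        push_cast
        module
      rw [e]; exact hper x hx (-i) (-j)
  by_cases hsame : σ 0 = σ' 0
  · -- translation pair: disjoint grains, full flux
    have hdisj := coaxial_disjoint_of_sameWord A₁ t₁ A₂ t₂ L s₁ s₂ hσ hσ' hsub₁ hsub₂ hsame hne
    have h := card_inPlane_runEnds_ge_of_disjoint A₁ t₁ A₂ t₂ X P₁ P₂ R₀ h ρ (by linarith) hρ hX hcell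
      hP₁X hP₂X hP₁ hP₂ hdisj hu hup hinv₂
    have hkey : 2 / 3 * Real.sqrt 2 * a * Real.pi * ρ ^ 2 - (12 * Real.sqrt 2 * Real.pi + 72 * R₀) * ρ ≤
        Real.sqrt 2 * a * Real.pi * (ρ - 1) ^ 2 - 10 * Real.sqrt 2 * Real.pi * (ρ - 1) - 72 * R₀ * ρ := by
      have e1 : Real.sqrt 2 * a * Real.pi * (ρ - 1) ^ 2 - 10 * Real.sqrt 2 * Real.pi * (ρ - 1) - 72 * R₀ * ρ -
          (2 / 3 * Real.sqrt 2 * a * Real.pi * ρ ^ 2 - (12 * Real.sqrt 2 * Real.pi + 72 * R₀) * ρ) =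
          M * a * (1 / 3 * ρ ^ 2 - 2 * ρ + 1) + 2 * M * ρ + 10 * M := by rw [hM]; ring
      have h1 : 0 ≤ 1 / 3 * ρ ^ 2 - 2 * ρ + 1 := by nlinarith
      have h2 : 0 ≤ M * a * (1 / 3 * ρ ^ 2 - 2 * ρ + 1) := by positivity
      nlinarith [mul_nonneg hM0 hρ0]
    exact hkey.trans h
  · -- twin pair: the layer shift, two thirds of the flux
    obtain ⟨hg1, hgΛ₁, hgΛ₂⟩ := coaxial_layerShift A₁ t₁ A₂ t₂ L s₁ s₂ hσ hσ' hsub₁ hsub₂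
    have h := card_inPlane_runEnds_ge_of_shift A₁ t₁ A₂ t₂ X P₁ P₂ R₀ h ρ (by linarith) hρ hX hcell
      hP₁X hP₂X hP₁ hP₂ hg1 hgΛ₁ (hgΛ₂ hsame) hu hup hinv₂
    have hkey : 2 / 3 * Real.sqrt 2 * a * Real.pi * ρ ^ 2 - (12 * Real.sqrt 2 * Real.pi + 72 * R₀) * ρ ≤
        2 / 3 * (Real.sqrt 2 * a * Real.pi * (ρ - 2) ^ 2 - 10 * Real.sqrt 2 * Real.pi * (ρ - 2)) - 72 * R₀ * ρ := by
      have e1 : 2 / 3 * (Real.sqrt 2 * a * Real.pi * (ρ - 2) ^ 2 - 10 * Real.sqrt 2 * Real.pi * (ρ - 2)) -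
          72 * R₀ * ρ - (2 / 3 * Real.sqrt 2 * a * Real.pi * ρ ^ 2 - (12 * Real.sqrt 2 * Real.pi + 72 * R₀) * ρ) =
          8 / 3 * M * (1 - a) * ρ + 8 / 3 * M * a + 8 / 3 * M * ρ + 40 / 3 * M := by rw [hM]; ring
      have h1 : 0 ≤ 1 - a := by linarith
      have h2 : 0 ≤ 8 / 3 * M * (1 - a) * ρ := by positivity
      nlinarith [mul_nonneg hM0 hρ0, mul_nonneg hM0 ha0]
    exact hkey.trans h

/-! ## The layered rung -/

open scoped Classical in
/-- **The LAYERED rung of `stub_coaxialTwoSlabAdhesion`, sharp form** (constant `√6/3`, explicit frame).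
See the module docstring. -/
theorem coaxialTwoSlabAdhesion_layered_sharp
    (A₁ : EuclideanSpace ℝ (Fin 3) ≃ₗᵢ[ℝ] EuclideanSpace ℝ (Fin 3)) (t₁ : EuclideanSpace ℝ (Fin 3))
    (A₂ : EuclideanSpace ℝ (Fin 3) ≃ₗᵢ[ℝ] EuclideanSpace ℝ (Fin 3)) (t₂ : EuclideanSpace ℝ (Fin 3))
    (L : EuclideanSpace ℝ (Fin 3) ≃ₗᵢ[ℝ] EuclideanSpace ℝ (Fin 3)) (s₁ s₂ : EuclideanSpace ℝ (Fin 3))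
    {σ σ' : ℤ → ℤ} (hσ : IsHaggSeq σ) (hσ' : IsHaggSeq σ')
    (hsub₁ : (fun p => A₁ p + t₁) '' fccStacking 1 (Real.sqrt (2 / 3)) ⊆
      (fun p => L p + s₁) '' barlowStacking 1 (Real.sqrt (2 / 3)) σ)
    (hsub₂ : (fun p => A₂ p + t₂) '' fccStacking 1 (Real.sqrt (2 / 3)) ⊆
      (fun p => L p + s₂) '' barlowStacking 1 (Real.sqrt (2 / 3)) σ')
    (hne : (fun p => A₁ p + t₁) '' fccStacking 1 (Real.sqrt (2 / 3)) ≠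
      (fun p => A₂ p + t₂) '' fccStacking 1 (Real.sqrt (2 / 3))) :
    ∃ C R₀ : ℝ, 1 ≤ R₀ ∧ ∀ h : ℝ, 0 ≤ h → ∀ ρ : ℝ, R₀ ≤ ρ →
      ∀ X P₁ P₂ : Finset (EuclideanSpace ℝ (Fin 3)),
      (∀ p ∈ X, ∀ q ∈ X, p ≠ q → 1 ≤ dist p q) → P₁ ⊆ X → P₂ ⊆ X \ P₁ →
      (∀ p ∈ X, -(2 * R₀) ≤ p 2 ∧ p 2 ≤ h + 2 * R₀ ∧ p 0 ^ 2 + p 1 ^ 2 ≤ ρ ^ 2) →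
      (∀ p, p ∈ P₁ ↔ (p ∈ (fun q => A₁ q + t₁) '' fccStacking 1 (Real.sqrt (2 / 3)) ∧
        -(2 * R₀) ≤ p 2 ∧ p 2 ≤ -R₀ ∧ p 0 ^ 2 + p 1 ^ 2 ≤ ρ ^ 2)) →
      (∀ p, p ∈ P₂ ↔ (p ∈ (fun q => A₂ q + t₂) '' fccStacking 1 (Real.sqrt (2 / 3)) ∧
        h + R₀ ≤ p 2 ∧ p 2 ≤ h + 2 * R₀ ∧ p 0 ^ 2 + p 1 ^ 2 ≤ ρ ^ 2)) →
      (∀ p ∈ X, ∃ i j c k : ℤ, p = L ((i : ℝ) • triangularVec₁ (1 : ℝ) + (j : ℝ) • triangularVec₂ (1 : ℝ) +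
        (c : ℝ) • barlowOffset (1 : ℝ) + (k : ℝ) • layerNormal (Real.sqrt (2 / 3))) + s₁) →
      ((((P₁ ×ˢ (X \ P₁)).filter fun pq => dist pq.1 pq.2 = 1).card : ℕ) : ℝ) +
        ((((P₂ ×ˢ ((X \ P₁) \ P₂)).filter fun pq => dist pq.1 pq.2 = 1).card : ℕ) : ℝ) ≤
        contactDeficiency ((X \ P₁) \ P₂) +
          (Real.sqrt 2 / 4 * ∑ᶠ w ∈ {w ∈ fccStacking 1 (Real.sqrt (2 / 3)) | ‖w‖ = 1},
              |⟪w, A₁.symm (EuclideanSpace.single (2 : Fin 3) (1 : ℝ))⟫_ℝ| +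
            Real.sqrt 2 / 4 * ∑ᶠ w ∈ {w ∈ fccStacking 1 (Real.sqrt (2 / 3)) | ‖w‖ = 1},
              |⟪w, A₂.symm (EuclideanSpace.single (2 : Fin 3) (1 : ℝ))⟫_ℝ| -
            (Real.sqrt 6 / 3 : ℝ) * Real.sqrt (1 - ⟪L (EuclideanSpace.single (2 : Fin 3) (1 : ℝ)),
              (EuclideanSpace.single (2 : Fin 3) (1 : ℝ))⟫_ℝ ^ 2)) * Real.pi * ρ ^ 2 +
          C * (1 + h) * ρ := by
  set e₃ : EuclideanSpace ℝ (Fin 3) := EuclideanSpace.single (2 : Fin 3) (1 : ℝ) with he₃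
  set s : ℝ := Real.sqrt (1 - ⟪L e₃, e₃⟫_ℝ ^ 2) with hs
  have hs0 : 0 ≤ s := Real.sqrt_nonneg _
  obtain ⟨Cpa, hCpa⟩ := twoSlab_cross_le_of_deficit A₁ t₁ A₂ t₂ 10 (by norm_num)
  set C₀ : ℝ := 3 * (12 * Real.sqrt 2 * Real.pi + 72 * 10) with hC₀
  have hC₀0 : 0 ≤ C₀ := by positivity
  -- the three signed in-plane classes as non-descending slots of grain 1
  obtain ⟨hn₁, hn₂, hn₁₂⟩ := norm_triangularVec_one
  have hv₁ : (((1 : ℤ) : ℝ)) • triangularVec₁ (1 : ℝ) + (((0 : ℤ) : ℝ)) • triangularVec₂ (1 : ℝ) =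
      triangularVec₁ 1 := by simp
  have hv₂ : (((0 : ℤ) : ℝ)) • triangularVec₁ (1 : ℝ) + (((1 : ℤ) : ℝ)) • triangularVec₂ (1 : ℝ) =
      triangularVec₂ 1 := by simp
  have hv₃ : (((-1 : ℤ) : ℝ)) • triangularVec₁ (1 : ℝ) + (((1 : ℤ) : ℝ)) • triangularVec₂ (1 : ℝ) =
      triangularVec₂ 1 - triangularVec₁ 1 := by push_cast; module
  obtain ⟨ε₁, hε₁, w₁, hw₁, hA₁, hup₁⟩ := exists_up_slot_of_inPlane_class A₁ t₁ L s₁ hσ hsub₁ 1 0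
    (by rw [hv₁]; exact hn₁)
  obtain ⟨ε₂, hε₂, w₂, hw₂, hA₂, hup₂⟩ := exists_up_slot_of_inPlane_class A₁ t₁ L s₁ hσ hsub₁ 0 1
    (by rw [hv₂]; exact hn₂)
  obtain ⟨ε₃, hε₃, w₃, hw₃, hA₃, hup₃⟩ := exists_up_slot_of_inPlane_class A₁ t₁ L s₁ hσ hsub₁ (-1) 1
    (by rw [hv₃]; exact hn₁₂)
  refine ⟨Cpa + C₀ / 2, 10, by norm_num, ?_⟩
  intro h hh ρ hρ X P₁ P₂ hX hP₁X hP₂X₁ hcell hP₁ hP₂ hlay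
  have hP₂X : P₂ ⊆ X := hP₂X₁.trans sdiff_subset
  have hρ0 : (0 : ℝ) ≤ ρ := by linarith
  -- the three located run-end counts
  have hE₁ := card_inPlane_runEnds_ge_coaxial A₁ t₁ A₂ t₂ L s₁ s₂ hσ hσ' hsub₁ hsub₂ hne X P₁ P₂ 10 h ρ le_rfl hρ
    hX hcell hP₁X hP₂X hP₁ hP₂ hw₁ hup₁ hε₁ 1 0 hA₁
  have hE₂ := card_inPlane_runEnds_ge_coaxial A₁ t₁ A₂ t₂ L s₁ s₂ hσ hσ' hsub₁ hsub₂ hne X P₁ P₂ 10 h ρ le_rfl hρ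
    hX hcell hP₁X hP₂X hP₁ hP₂ hw₂ hup₂ hε₂ 0 1 hA₂
  have hE₃ := card_inPlane_runEnds_ge_coaxial A₁ t₁ A₂ t₂ L s₁ s₂ hσ hσ' hsub₁ hsub₂ hne X P₁ P₂ 10 h ρ le_rfl hρ
    hX hcell hP₁X hP₂X hP₁ hP₂ hw₃ hup₃ hε₃ (-1) 1 hA₃
  rw [hv₁] at hA₁
  rw [hv₂] at hA₂
  rw [hv₃] at hA₃
  -- the fluxes of the three classes carry the sine
  have habs : ∀ {ε : ℝ} (v : EuclideanSpace ℝ (Fin 3)), (ε = 1 ∨ ε = -1) →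
      |⟪L (ε • v), e₃⟫_ℝ| = |⟪L v, e₃⟫_ℝ| := by
    intro ε v hε
    rcases hε with rfl | rfl
    · rw [one_smul]
    · rw [neg_one_smul, map_neg, inner_neg_left, abs_neg]
  have hflux : Real.sqrt 6 * s ≤ Real.sqrt 2 * (|⟪A₁ w₁, e₃⟫_ℝ| + |⟪A₁ w₂, e₃⟫_ℝ| + |⟪A₁ w₃, e₃⟫_ℝ|) := by
    rw [hA₁, hA₂, hA₃, habs _ hε₁, habs _ hε₂, habs _ hε₃]
    exact coaxial_sine_le_inPlaneClasses L
  -- the window sum and the local law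
  set Xwin := X.filter fun z => -(10 : ℝ) - 2 ≤ z 2 ∧ z 2 ≤ h + 10 + 2 with hXwin
  set SIX : Finset (EuclideanSpace ℝ (Fin 3)) := {L (triangularVec₁ 1), -L (triangularVec₁ 1),
    L (triangularVec₂ 1), -L (triangularVec₂ 1), L (triangularVec₂ 1 - triangularVec₁ 1),
    -L (triangularVec₂ 1 - triangularVec₁ 1)} with hSIX
  have hloc : ∀ z ∈ Xwin, ((SIX.filter fun d => z + d ∉ X).card : ℝ) ≤
      (12 : ℝ) - ((X.filter fun q => dist z q = 1).card : ℝ) := by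
    intro z hz
    have hzX : z ∈ X := (mem_filter.1 hz).1
    have h := layered_card_contacts_add_vacant_le L s₁ X hX hlay hzX
    have h' : (((X.filter fun q => dist z q = 1).card : ℕ) : ℝ) +
        (((SIX.filter fun d => z + d ∉ X).card : ℕ) : ℝ) ≤ 12 := by exact_mod_cast h
    linarith
  -- swap the double count
  have hswap : ∑ z ∈ Xwin, (SIX.filter fun d => z + d ∉ X).card =
      ∑ d ∈ SIX, (Xwin.filter fun z => z + d ∉ X).card := by
    rw [Finset.sum_congr rfl (fun z _ => Finset.card_filter (fun d => z + d ∉ X) SIX), Finset.sum_comm]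
    refine sum_congr rfl fun d _ => ?_
    rw [Finset.card_filter]
  -- the three classes inside the six, pairwise distinct
  have hmem : ∀ {ε : ℝ} (v : EuclideanSpace ℝ (Fin 3)), (ε = 1 ∨ ε = -1) → (L v ∈ SIX ∧ -L v ∈ SIX) →
      L (ε • v) ∈ SIX := by
    intro ε v hε hv
    rcases hε with rfl | rfl
    · rw [one_smul]; exact hv.1
    · rw [neg_one_smul, map_neg]; exact hv.2
  have hd₁m : A₁ w₁ ∈ SIX := by rw [hA₁]; exact hmem _ hε₁ (by simp [hSIX])
  have hd₂m : A₁ w₂ ∈ SIX := by rw [hA₂]; exact hmem _ hε₂ (by simp [hSIX])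
  have hd₃m : A₁ w₃ ∈ SIX := by rw [hA₃]; exact hmem _ hε₃ (by simp [hSIX])
  obtain ⟨h12, -, -⟩ := inPlane_classes_ne hε₁ hε₂
  obtain ⟨-, h13, -⟩ := inPlane_classes_ne hε₁ hε₃
  obtain ⟨-, -, h23⟩ := inPlane_classes_ne hε₂ hε₃
  have hne12 : A₁ w₁ ≠ A₁ w₂ := by rw [hA₁, hA₂]; exact fun h => h12 (L.injective h)
  have hne13 : A₁ w₁ ≠ A₁ w₃ := by rw [hA₁, hA₃]; exact fun h => h13 (L.injective h)
  have hne23 : A₁ w₂ ≠ A₁ w₃ := by rw [hA₂, hA₃]; exact fun h => h23 (L.injective h)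
  have hsub3 : ({A₁ w₁, A₁ w₂, A₁ w₃} : Finset (EuclideanSpace ℝ (Fin 3))) ⊆ SIX := by
    intro d hd
    simp only [mem_insert, mem_singleton] at hd
    rcases hd with rfl | rfl | rfl
    · exact hd₁m
    · exact hd₂m
    · exact hd₃m
  have hthree : ∑ d ∈ ({A₁ w₁, A₁ w₂, A₁ w₃} : Finset (EuclideanSpace ℝ (Fin 3))),
      (Xwin.filter fun z => z + d ∉ X).card =
      (Xwin.filter fun z => z + A₁ w₁ ∉ X).card + (Xwin.filter fun z => z + A₁ w₂ ∉ X).card +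
        (Xwin.filter fun z => z + A₁ w₃ ∉ X).card := by
    rw [sum_insert (by simp [hne12, hne13]), sum_insert (by simp [hne23]), sum_singleton]
    ring
  have hsub_sum : ∑ d ∈ ({A₁ w₁, A₁ w₂, A₁ w₃} : Finset (EuclideanSpace ℝ (Fin 3))),
      (Xwin.filter fun z => z + d ∉ X).card ≤ ∑ d ∈ SIX, (Xwin.filter fun z => z + d ∉ X).card :=
    sum_le_sum_of_subset_of_nonneg hsub3 (fun _ _ _ => Nat.zero_le _)
  -- located ends are window balls with a vacant successor
  have hEsub : ∀ d : EuclideanSpace ℝ (Fin 3),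
      (X.filter fun e => e ∈ (fun q => A₁ q + t₁) '' fccStacking 1 (Real.sqrt (2 / 3)) ∧
        e ∉ (fun q => A₂ q + t₂) '' fccStacking 1 (Real.sqrt (2 / 3)) ∧ e + d ∉ X ∧
        -(10 : ℝ) - 2 ≤ e 2 ∧ e 2 ≤ h + 10 + 2).card ≤ (Xwin.filter fun z => z + d ∉ X).card := by
    intro d
    refine card_le_card ?_
    intro e he
    rw [mem_filter] at he
    rw [mem_filter, hXwin, mem_filter]
    exact ⟨⟨he.1, he.2.2.2.2⟩, he.2.2.2.1⟩
  -- assemble the payer bound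
  set S : ℝ := ∑ z ∈ Xwin, ((12 : ℝ) - ((X.filter fun q => dist z q = 1).card : ℝ)) with hS
  have hS_ge : (((Xwin.filter fun z => z + A₁ w₁ ∉ X).card : ℕ) : ℝ) +
      (((Xwin.filter fun z => z + A₁ w₂ ∉ X).card : ℕ) : ℝ) +
      (((Xwin.filter fun z => z + A₁ w₃ ∉ X).card : ℕ) : ℝ) ≤ S := by
    have h1 : (∑ z ∈ Xwin, ((SIX.filter fun d => z + d ∉ X).card : ℝ)) ≤ S := sum_le_sum hloc
    have h2 : ((∑ d ∈ ({A₁ w₁, A₁ w₂, A₁ w₃} : Finset (EuclideanSpace ℝ (Fin 3))),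
        (Xwin.filter fun z => z + d ∉ X).card : ℕ) : ℝ) ≤
        ((∑ d ∈ SIX, (Xwin.filter fun z => z + d ∉ X).card : ℕ) : ℝ) := by exact_mod_cast hsub_sum
    rw [hthree] at h2
    rw [← hswap] at h2
    push_cast at h1 h2
    linarith
  have hE₁' := hE₁.trans (Nat.cast_le.2 (hEsub (A₁ w₁)))
  have hE₂' := hE₂.trans (Nat.cast_le.2 (hEsub (A₁ w₂)))
  have hE₃' := hE₃.trans (Nat.cast_le.2 (hEsub (A₁ w₃)))
  have hpay : (2 / 3 * Real.sqrt 6 * s) * Real.pi * ρ ^ 2 - C₀ * (1 + h) * ρ ≤ S := by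
    set a₁ := |⟪A₁ w₁, e₃⟫_ℝ| with ha₁
    set a₂ := |⟪A₁ w₂, e₃⟫_ℝ| with ha₂
    set a₃ := |⟪A₁ w₃, e₃⟫_ℝ| with ha₃
    set Q : ℝ := Real.sqrt 2 * Real.pi * ρ ^ 2 with hQ
    have hQ0 : 0 ≤ Q := by positivity
    have e₁ : 2 / 3 * Real.sqrt 2 * a₁ * Real.pi * ρ ^ 2 = 2 / 3 * a₁ * Q := by rw [hQ]; ring
    have e₂ : 2 / 3 * Real.sqrt 2 * a₂ * Real.pi * ρ ^ 2 = 2 / 3 * a₂ * Q := by rw [hQ]; ring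
    have e₃' : 2 / 3 * Real.sqrt 2 * a₃ * Real.pi * ρ ^ 2 = 2 / 3 * a₃ * Q := by rw [hQ]; ring
    rw [e₁] at hE₁'
    rw [e₂] at hE₂'
    rw [e₃'] at hE₃'
    have hsum : 2 / 3 * (a₁ + a₂ + a₃) * Q - C₀ * ρ ≤ S := by
      have eC : C₀ * ρ = 3 * ((12 * Real.sqrt 2 * Real.pi + 72 * 10) * ρ) := by rw [hC₀]; ring
      rw [eC]
      linarith [hE₁', hE₂', hE₃', hS_ge]
    have h1 : Real.sqrt 6 * s * (Real.pi * ρ ^ 2) ≤ (a₁ + a₂ + a₃) * Q := by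
      have := mul_le_mul_of_nonneg_right hflux (show (0 : ℝ) ≤ Real.pi * ρ ^ 2 by positivity)
      have eQ : Real.sqrt 2 * (a₁ + a₂ + a₃) * (Real.pi * ρ ^ 2) = (a₁ + a₂ + a₃) * Q := by rw [hQ]; ring
      linarith [eQ]
    have h2 : C₀ * ρ ≤ C₀ * (1 + h) * ρ := by
      have : 0 ≤ C₀ * h * ρ := by positivity
      linarith [show C₀ * (1 + h) * ρ = C₀ * ρ + C₀ * h * ρ by ring]
    have e4 : (2 / 3 * Real.sqrt 6 * s) * Real.pi * ρ ^ 2 = 2 / 3 * (Real.sqrt 6 * s * (Real.pi * ρ ^ 2)) := by ring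
    rw [e4]
    linarith [h1, h2, hsum]
  -- the payer assembly
  have hfin := hCpa h hh ρ hρ X P₁ P₂ hX hP₁X hP₂X₁ hcell hP₁ hP₂ (2 / 3 * Real.sqrt 6 * s) C₀ hC₀0 hpay
  have e63 : 2 / 3 * Real.sqrt 6 * s / 2 = Real.sqrt 6 / 3 * s := by ring
  rw [e63] at hfin
  have eC : (Cpa + C₀ / 2) * (1 + h) * ρ = (Cpa + C₀ / 2) * (1 + h) * ρ := rfl
  linarith [hfin]

/-- **The LAYERED rung of `stub_coaxialTwoSlabAdhesion`** — the stub's hypotheses and conclusion VERBATIM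
(constant `½`, the frame re-picked as the given one), with the single extra premise «every ball of `X` is a
site of the co-axial site lattice of `(L, s₁)`» inside.  See the module docstring. -/
theorem coaxialTwoSlabAdhesion_layered
    (A₁ : EuclideanSpace ℝ (Fin 3) ≃ₗᵢ[ℝ] EuclideanSpace ℝ (Fin 3)) (t₁ : EuclideanSpace ℝ (Fin 3))
    (A₂ : EuclideanSpace ℝ (Fin 3) ≃ₗᵢ[ℝ] EuclideanSpace ℝ (Fin 3)) (t₂ : EuclideanSpace ℝ (Fin 3))
    (hcoax : ∃ (L : EuclideanSpace ℝ (Fin 3) ≃ₗᵢ[ℝ] EuclideanSpace ℝ (Fin 3))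
        (s₁ s₂ : EuclideanSpace ℝ (Fin 3)) (σ σ' : ℤ → ℤ), IsHaggSeq σ ∧ IsHaggSeq σ' ∧
        (fun p => A₁ p + t₁) '' fccStacking 1 (Real.sqrt (2 / 3)) ⊆
          (fun p => L p + s₁) '' barlowStacking 1 (Real.sqrt (2 / 3)) σ ∧
        (fun p => A₂ p + t₂) '' fccStacking 1 (Real.sqrt (2 / 3)) ⊆
          (fun p => L p + s₂) '' barlowStacking 1 (Real.sqrt (2 / 3)) σ')
    (hne : (fun p => A₁ p + t₁) '' fccStacking 1 (Real.sqrt (2 / 3)) ≠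
      (fun p => A₂ p + t₂) '' fccStacking 1 (Real.sqrt (2 / 3))) :
    ∃ (L : EuclideanSpace ℝ (Fin 3) ≃ₗᵢ[ℝ] EuclideanSpace ℝ (Fin 3))
        (s₁ s₂ : EuclideanSpace ℝ (Fin 3)) (σ σ' : ℤ → ℤ), IsHaggSeq σ ∧ IsHaggSeq σ' ∧
        (fun p => A₁ p + t₁) '' fccStacking 1 (Real.sqrt (2 / 3)) ⊆
          (fun p => L p + s₁) '' barlowStacking 1 (Real.sqrt (2 / 3)) σ ∧
        (fun p => A₂ p + t₂) '' fccStacking 1 (Real.sqrt (2 / 3)) ⊆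
          (fun p => L p + s₂) '' barlowStacking 1 (Real.sqrt (2 / 3)) σ' ∧
    ∃ C R₀ : ℝ, 1 ≤ R₀ ∧ ∀ h : ℝ, 0 ≤ h → ∀ ρ : ℝ, R₀ ≤ ρ →
      ∀ X P₁ P₂ : Finset (EuclideanSpace ℝ (Fin 3)),
      (∀ p ∈ X, ∀ q ∈ X, p ≠ q → 1 ≤ dist p q) → P₁ ⊆ X → P₂ ⊆ X \ P₁ →
      (∀ p ∈ X, -(2 * R₀) ≤ p 2 ∧ p 2 ≤ h + 2 * R₀ ∧ p 0 ^ 2 + p 1 ^ 2 ≤ ρ ^ 2) →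
      (∀ p, p ∈ P₁ ↔ (p ∈ (fun q => A₁ q + t₁) '' fccStacking 1 (Real.sqrt (2 / 3)) ∧
        -(2 * R₀) ≤ p 2 ∧ p 2 ≤ -R₀ ∧ p 0 ^ 2 + p 1 ^ 2 ≤ ρ ^ 2)) →
      (∀ p, p ∈ P₂ ↔ (p ∈ (fun q => A₂ q + t₂) '' fccStacking 1 (Real.sqrt (2 / 3)) ∧
        h + R₀ ≤ p 2 ∧ p 2 ≤ h + 2 * R₀ ∧ p 0 ^ 2 + p 1 ^ 2 ≤ ρ ^ 2)) →
      (∀ p ∈ X, ∃ i j c k : ℤ, p = L ((i : ℝ) • triangularVec₁ (1 : ℝ) + (j : ℝ) • triangularVec₂ (1 : ℝ) +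
        (c : ℝ) • barlowOffset (1 : ℝ) + (k : ℝ) • layerNormal (Real.sqrt (2 / 3))) + s₁) →
      ((((P₁ ×ˢ (X \ P₁)).filter fun pq => dist pq.1 pq.2 = 1).card : ℕ) : ℝ) +
        ((((P₂ ×ˢ ((X \ P₁) \ P₂)).filter fun pq => dist pq.1 pq.2 = 1).card : ℕ) : ℝ) ≤
        contactDeficiency ((X \ P₁) \ P₂) +
          (Real.sqrt 2 / 4 * ∑ᶠ w ∈ {w ∈ fccStacking 1 (Real.sqrt (2 / 3)) | ‖w‖ = 1},
              |⟪w, A₁.symm (EuclideanSpace.single (2 : Fin 3) (1 : ℝ))⟫_ℝ| +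
            Real.sqrt 2 / 4 * ∑ᶠ w ∈ {w ∈ fccStacking 1 (Real.sqrt (2 / 3)) | ‖w‖ = 1},
              |⟪w, A₂.symm (EuclideanSpace.single (2 : Fin 3) (1 : ℝ))⟫_ℝ| -
            (1 / 2 : ℝ) * Real.sqrt (1 - ⟪L (EuclideanSpace.single (2 : Fin 3) (1 : ℝ)),
              (EuclideanSpace.single (2 : Fin 3) (1 : ℝ))⟫_ℝ ^ 2)) * Real.pi * ρ ^ 2 +
          C * (1 + h) * ρ := by
  obtain ⟨L, s₁, s₂, σ, σ', hσ, hσ', hsub₁, hsub₂⟩ := hcoax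
  obtain ⟨C, R₀, hR₀, hmain⟩ := coaxialTwoSlabAdhesion_layered_sharp A₁ t₁ A₂ t₂ L s₁ s₂ hσ hσ' hsub₁ hsub₂ hne
  refine ⟨L, s₁, s₂, σ, σ', hσ, hσ', hsub₁, hsub₂, C, R₀, hR₀, ?_⟩
  intro h hh ρ hρ X P₁ P₂ hX hP₁X hP₂X hcell hP₁ hP₂ hlay
  have hfin := hmain h hh ρ hρ X P₁ P₂ hX hP₁X hP₂X hcell hP₁ hP₂ hlay
  have hs0 : 0 ≤ Real.sqrt (1 - ⟪L (EuclideanSpace.single (2 : Fin 3) (1 : ℝ)),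
      (EuclideanSpace.single (2 : Fin 3) (1 : ℝ))⟫_ℝ ^ 2) := Real.sqrt_nonneg _
  have h6 : (1 / 2 : ℝ) ≤ Real.sqrt 6 / 3 := by
    have h4 : Real.sqrt 4 = 2 := by
      rw [show (4 : ℝ) = 2 ^ 2 by norm_num, Real.sqrt_sq (by norm_num)]
    have h46 : Real.sqrt 4 ≤ Real.sqrt 6 := Real.sqrt_le_sqrt (by norm_num)
    rw [h4] at h46
    linarith
  have hρ0 : (0 : ℝ) ≤ Real.pi * ρ ^ 2 := by positivity
  nlinarith [hfin, mul_le_mul_of_nonneg_right h6 (mul_nonneg hs0 hρ0)]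

end Summit.Ventures.Crystal3D.Theorems

end
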